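import Summits.RiemannHypothesis.RiemannHypothesis.Theorems.RuelleBandExactFirstBandStubHeatSummable
import HarnessLib

/-!
# RiemannHypothesis / RuelleBand — the zero heat trace is bounded on every `[t₀, ∞)`

Route `RiemannHypothesis/RuelleBand`, crux item stmt-RiemannHypothesis-2061 (`ExactFirstBand`),
line `Sketch (heat cone)`, stub `stub_heatBounded` (helper file, `--supports`).

**Statement.** With `m(ρ) = riemannZetaZeroOrder ρ` and `λ_ρ = ρ(1-ρ)`, the zero heat trace
`Z(t) = Σ_ρ m(ρ) e^{-t λ_ρ}` over the non-trivial zeros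
(`Literature.NumberTheory.LFunctions.ZetaZeros.riemannZetaNontrivialZeros`) satisfies: for every
`t₀ > 0` there is `M` with `|Re Z(t)| ≤ M` for all `t ≥ t₀`.  This is the field `bdd` of the
tree's `Literature.Analysis.OperatorTheory.IsBoundedHalfLinePD` for `f = Re Z`.

**Proof.** For a non-trivial zero `ρ = β + iγ` (`0 < β < 1`), `Re λ_ρ = β(1-β) + γ² ≥ γ² ≥ 0`
(`stub_heatSummable_sq_im_le_re`), and `Σ_ρ m(ρ) e^{-t Re λ_ρ} < ∞` for every `t > 0` is the
sibling stub `stub_heatSummable` (`RuelleBandExactFirstBandStubHeatSummable.lean`, from the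
tree's `weilZeroSummable`, Jensen); since `‖m(ρ) e^{-tλ_ρ}‖ = m(ρ) e^{-t Re λ_ρ}`
(`stub_heatBounded_norm_term`) this is absolute summability of `Z(t)`.  Then for `t ≥ t₀ > 0`,
`|Re Z(t)| ≤ ‖Z(t)‖ ≤ Σ ‖m(ρ) e^{-tλ_ρ}‖ = Σ m(ρ) e^{-t Re λ_ρ} ≤ Σ m(ρ) e^{-t₀ Re λ_ρ} =: M`
(`Complex.abs_re_le_norm`, `norm_tsum_le_tsum_norm`, `Summable.tsum_le_tsum`).

Mathlib + the sibling stub file (hence `Literature.NumberTheory.LFunctions.WeilZeroSum`) only; no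
named fact is used; no definitions.
-/

set_option linter.dupNamespace false

noncomputable section

open Complex Filter Set
open scoped BigOperators Topology

namespace Summit.RiemannHypothesis.RiemannHypothesis.Theorems.RuelleBandExactFirstBand

open Literature.NumberTheory.LFunctions

/-- On the non-trivial zeros, `0 ≤ Re(ρ(1-ρ))` (`Re(ρ(1-ρ)) ≥ γ²`,
`stub_heatSummable_sq_im_le_re`). [folklore] -/
theorem stub_heatBounded_re_nonneg {ρ : ℂ} (h : ρ ∈ ZetaZeros.riemannZetaNontrivialZeros) :
    0 ≤ (ρ * (1 - ρ)).re :=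
  (sq_nonneg _).trans (stub_heatSummable_sq_im_le_re
    (ZetaZeros.riemannZetaNontrivialZeros.re_pos h) (ZetaZeros.riemannZetaNontrivialZeros.re_lt_one h))

/-- The summand at a non-trivial zero has norm `m(ρ) e^{-t Re λ_ρ}` (`m(ρ) ≥ 0` off the pole,
`‖e^z‖ = e^{Re z}`). [folklore] -/
theorem stub_heatBounded_norm_term (t : ℝ) {ρ : ℂ}
    (h : ρ ∈ ZetaZeros.riemannZetaNontrivialZeros) :
    ‖(riemannZetaZeroOrder ρ : ℂ) * cexp (-((t : ℂ) * (ρ * (1 - ρ))))‖ =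
      (riemannZetaZeroOrder ρ : ℝ) * Real.exp (-(t * (ρ * (1 - ρ)).re)) := by
  have hm : (0 : ℝ) ≤ riemannZetaZeroOrder ρ := by
    exact_mod_cast riemannZetaZeroOrder_nonneg (ZetaZeros.riemannZetaNontrivialZeros.ne_one h)
  rw [norm_mul, Complex.norm_intCast, abs_of_nonneg hm, Complex.norm_exp, neg_re, re_ofReal_mul]

/-- **Absolute summability of the heat trace** for `t > 0`: `Σ_ρ ‖m(ρ) e^{-tλ_ρ}‖ < ∞` over the
non-trivial zeros — the sibling stub `stub_heatSummable` rewritten through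
`stub_heatBounded_norm_term`. [folklore] -/
theorem stub_heatBounded_summable_norm {t : ℝ} (ht : 0 < t) :
    Summable fun ρ : ZetaZeros.riemannZetaNontrivialZeros ↦
      ‖(riemannZetaZeroOrder (ρ : ℂ) : ℂ) * cexp (-((t : ℂ) * ((ρ : ℂ) * (1 - (ρ : ℂ)))))‖ :=
  (stub_heatSummable t ht).congr fun ρ ↦ (stub_heatBounded_norm_term t ρ.2).symm

/-- **Stub `stub_heatBounded` (S) — boundedness of the zero heat trace on every `[t₀, ∞)`.**
For `t ≥ t₀ > 0`,
`|Re Σ_ρ m(ρ) e^{-tρ(1-ρ)}| ≤ Σ_ρ m(ρ) e^{-t Re(ρ(1-ρ))} ≤ Σ_ρ m(ρ) e^{-t₀ Re(ρ(1-ρ))} =: M`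
(`Re(ρ(1-ρ)) ≥ 0` on the non-trivial zeros; absolute summability
`stub_heatBounded_summable_norm`, i.e. `stub_heatSummable`, from `weilZeroSummable`). [folklore] -/
theorem stub_heatBounded :
    ∀ t₀ : ℝ, 0 < t₀ → ∃ M : ℝ, ∀ t : ℝ, t₀ ≤ t →
      |(∑' ρ : ZetaZeros.riemannZetaNontrivialZeros,
          (riemannZetaZeroOrder (ρ : ℂ) : ℂ) * cexp (-((t : ℂ) * ((ρ : ℂ) * (1 - (ρ : ℂ)))))).re| ≤ M := by
  intro t₀ ht₀
  refine ⟨∑' ρ : ZetaZeros.riemannZetaNontrivialZeros,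
    ‖(riemannZetaZeroOrder (ρ : ℂ) : ℂ) * cexp (-((t₀ : ℂ) * ((ρ : ℂ) * (1 - (ρ : ℂ)))))‖, ?_⟩
  intro t ht
  have htpos : 0 < t := ht₀.trans_le ht
  refine (Complex.abs_re_le_norm _).trans
    ((norm_tsum_le_tsum_norm (stub_heatBounded_summable_norm htpos)).trans ?_)
  refine Summable.tsum_le_tsum (fun ρ ↦ ?_) (stub_heatBounded_summable_norm htpos)
    (stub_heatBounded_summable_norm ht₀)
  rw [stub_heatBounded_norm_term t ρ.2, stub_heatBounded_norm_term t₀ ρ.2]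
  have hm : (0 : ℝ) ≤ riemannZetaZeroOrder (ρ : ℂ) := by
    exact_mod_cast riemannZetaZeroOrder_nonneg (ZetaZeros.riemannZetaNontrivialZeros.ne_one ρ.2)
  exact mul_le_mul_of_nonneg_left (Real.exp_le_exp.2
    (neg_le_neg (mul_le_mul_of_nonneg_right ht (stub_heatBounded_re_nonneg ρ.2)))) hm

end Summit.RiemannHypothesis.RiemannHypothesis.Theorems.RuelleBandExactFirstBand

end
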